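import Mathlib
import Literature.Computability.AlgebraicComplexity.TableauHighestWeight
import Literature.Computability.AlgebraicComplexity.HwvEvaluationRankBound
import Summits.ValiantsHypothesis.ValiantsHypothesis.Theorems.GeneratorObstructionsPowGenDegreeQPDoublingGadgetSlice

/-!
# Route GeneratorObstructions — crux K2 `PowGenDegreeQP` (stmt-ValiantsHypothesis-11655), line
# `trace-side-regimes`: the tableau bridge — a nonvanishing tableau polynomial supplies the GIT input

Companion of `…PowGenDegreeQPDoublingGadgetWindow` / `…DoublingGadgetPow` / `…DixonParity`.
The conditional refutations of K2 ask for ONE highest-weight vector of nonconstant weight of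
`ℂ[Δ_m g]` not vanishing at the (canonical doubling gadget) point `g`.  The tree's tableau machinery
(`TableauEval.TabM`, `tabPoly_mem_highestWeightSpace`: the tableau polynomial of a datum whose column
alternators sit on the largest letters of an antitone enumeration is a `B`-semi-invariant of
`k[Sym^m]` of weight `χ(x_i) = -#{columns higher than i}`) turns this into pure combinatorics.  This
file packages the reduction once, for any form `f`:

* `aeval_formCoeff_tabPoly_eq_sum` — the value of a tableau polynomial at a form `f` in closed form:
  `F_τ(f) = Σ_π (∏_c sign π_c) · ∏_u α_u(π)! · coeff_{α_u(π)} f` (no presentation of `f` needed);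
* `exists_hwv_evalAtPoint_ne_zero_of_tabPoly` — **the bridge**: a framed tableau datum on the
  antitone enumeration `x` of `σ` with two rows `i, j < N` crossed by different numbers of columns
  (nonconstant weight) and `F_τ(f) ≠ 0` yields `χ₀` nonconstant and `y ∈ HWV_{χ₀}(ℂ[Δ_m f])` with
  `ev_f(y) ≠ 0` — exactly the hypothesis format of `not_powGenDegreeQP_of_canonicalGadgetGIT(_pow)`;
* (companion file `…PowGenDegreeQPMatIdxRevEnum`: the antitone enumeration `matIdxRevEnum` of the
  matrix letters `MatIdx n`, largest first, and the fact that a strictly monotone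
  `ι : Fin c → MatIdx n` onto a final segment lists its top `c` letters, `x i = ι (c-1-i)`).

What remains for the certificate (blueprint `evidence-11655-leafhand3-g5.md`): the explicit datum `τ`
for the gadget (shape `kc'(2^c,2^c,2^{c-1},2^{c-1},2^{c-1},…,2,2,2,1)`, `c' = 3`) and the count
`F_τ(g) = (k!(2k)!²)^d · (±((3k)!/(k!)^3) · E(k))^{2^c-1}`, `E(k)` the Dixon sum (`…DixonParity`).

Honest framing: plumbing; no stub, crux or summit is settled here; `VP ≠ VNP` untouched. [folklore]
-/

namespace Summit.ValiantsHypothesis.ValiantsHypothesis.Theorems.GeneratorObstructions.PowGenDegreeQP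

open MvPolynomial
open Literature.NumberTheory.DiophantineGeometry Literature.Computability.AlgebraicComplexity
  Literature.Computability.AlgebraicComplexity.TableauEval

-- `Summit.ValiantsHypothesis.ValiantsHypothesis.…` is the tree's mandated single-conjunct layout.
set_option linter.dupNamespace false

noncomputable section

section Bridge

variable {σ : Type*} [Fintype σ] [LinearOrder σ] {K : Type*} [CommRing K]

/-- **Closed form of the value of a tableau polynomial at a form**:
`F_τ(f) = Σ_π (∏_c sign π_c) ∏_u (α_u(π)! · coeff_{α_u(π)} f)`. [folklore] -/
theorem aeval_formCoeff_tabPoly_eq_sum (τ : TabM σ) (f : MvPolynomial σ K) :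
    aeval (formCoeff τ.m f) (τ.tabPoly K) =
      ∑ π : τ.Bij, ((τ.sgnProd π : ℤ) : K) *
        ∏ u, ((ffact (τ.content π u) : K) * coeff (τ.content π u) f) := by
  unfold TabM.tabPoly
  rw [map_sum]
  refine Finset.sum_congr rfl fun π _ => ?_
  rw [map_smul, map_prod, smul_eq_mul]
  congr 1
  refine Finset.prod_congr rfl fun u _ => ?_
  rw [map_smul, aeval_X, formCoeff_apply, smul_eq_mul]
  rfl

end Bridge

section BridgeC

variable {σ : Type*} [Fintype σ] [LinearOrder σ]

/-- **The tableau bridge.** Let `τ` be a framed tableau datum whose column alternators sit on the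
largest letters of an antitone enumeration `x` of `σ` (`var c r = x r`, heights `≤ N`), let two rows
`i, j < N` be crossed by different numbers of columns, and let the tableau polynomial not vanish at the
form `f`: `F_τ(f) ≠ 0`.  Then some highest-weight vector of NONCONSTANT weight of `ℂ[Δ_m f]`
(`m = τ.m`) does not vanish at `f` — the class of `F_τ` (`tabPoly_mem_highestWeightSpace`,
`mk_mem_highestWeightSpace_orbitCoordRep`, `evalAtPoint_mk`). [folklore] -/
theorem exists_hwv_evalAtPoint_ne_zero_of_tabPoly (τ : TabM σ) (F : τ.Frame) {x : ℕ → σ} {N : ℕ}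
    (hx : IsAntitoneEnum x N) (hh : ∀ c, τ.h c ≤ N) (hvar : ∀ c r, τ.var c r = x r)
    {i j : ℕ} (hi : i < N) (hj : j < N)
    (hij : (Finset.univ.filter fun c => i < τ.h c).card ≠
      (Finset.univ.filter fun c => j < τ.h c).card)
    (f : MvPolynomial σ ℂ) (hev : aeval (formCoeff τ.m f) (τ.tabPoly ℂ) ≠ 0) :
    ∃ χ₀ : Weight σ, (∃ a b, χ₀ a ≠ χ₀ b) ∧
      ∃ y ∈ highestWeightSpace (orbitCoordRep f τ.m) χ₀, evalAtPoint f τ.m y ≠ 0 := by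
  classical
  -- index of a letter in the enumeration
  have hidx : ∀ v : σ, ∃ n, n < N ∧ x n = v := fun v => by
    obtain ⟨n, hn, hv⟩ := hx.surj v
    exact ⟨n, hn, hv⟩
  choose idx hidx_lt hidx_x using hidx
  have hidx_eq : ∀ n < N, idx (x n) = n := fun n hn => hx.inj (hidx_lt _) hn (hidx_x _)
  -- the weight
  let χ : Weight σ := fun v => -((Finset.univ.filter fun c => idx v < τ.h c).card : ℤ)
  have hχ : ∀ n < N, χ (x n) = -((Finset.univ.filter fun c => n < τ.h c).card : ℤ) := by
    intro n hn
    simp only [χ, hidx_eq n hn]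
  have hF : τ.tabPoly ℂ ∈ highestWeightSpace (coordRep σ ℂ τ.m) χ :=
    τ.tabPoly_mem_highestWeightSpace F hx hh hvar χ hχ
  refine ⟨χ, ⟨x i, x j, ?_⟩, Ideal.Quotient.mkₐ ℂ (orbitVanishingIdeal f τ.m) (τ.tabPoly ℂ),
    mk_mem_highestWeightSpace_orbitCoordRep f τ.m hF, ?_⟩
  · rw [hχ i hi, hχ j hj]
    exact fun h => hij (by exact_mod_cast neg_inj.mp h)
  · rw [Ideal.Quotient.mkₐ_eq_mk, evalAtPoint_mk]
    exact hev

end BridgeC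

end

end Summit.ValiantsHypothesis.ValiantsHypothesis.Theorems.GeneratorObstructions.PowGenDegreeQP
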